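import Mathlib

/-!
# Route BarrierLever — item `PartitionMinorsHitByVP` (stmt-ValiantsHypothesis-19717), line `hidden_states`:
# ZERO-BASE CONFIGURATION MATRICES — a common generic table for finitely many row families

Helper file (`--supports stmt-ValiantsHypothesis-19717`; cell valiant-natproofs, rung V4, 𝒟-side door (c); prover seat
val-np-p3 gen 20). Bookkeeping `def`s `cfgMat`, `symMat`. Closes NO item. Memo HOME/val-np-p3/g20/MEMO-blockpeeling-valnp3-g20.md §3–§5.

`cfgMat U cols g = [∏_{a ∈ U i} Σ_{q ∈ cols k} g q a]_{i,k}` is the block-additive matrix of the line's stubs for ONE piece with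
base point `0` (row `i` = the monomial `x^{U i}`, column `k` = the subset sum of the states `cols k`); `symMat` is its symbolic
version over `MvPolynomial (Fin K × Fin h) ℂ` (`eval_det_symMat`).

* **`exists_common_table`** — if each of finitely many row families admits a table making its configuration matrix (same
  columns) nonsingular, ONE table does it for all of them: the product of the symbolic determinants is a nonzero polynomial,
  which has a non-root over `ℂ` (`MvPolynomial.funext`). This is the «generic table» step of every peeling induction
  (`…HiddenStatesMatching`).

WHAT THIS IS NOT: no design is proved good here; item 19717 stays OPEN; nothing on crux 14610 or VP ≠ VNP.
-/

set_option linter.dupNamespace false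

namespace Summit.ValiantsHypothesis.ValiantsHypothesis.Theorems.BarrierLever.HiddenStates

open Finset Matrix MvPolynomial

noncomputable section

namespace PairBlock

variable {h K n : ℕ}

/-! ## 1. The zero-base configuration matrix and a common generic table -/

/-- The configuration matrix of a zero-base piece: row `i` = monomial `x^{U i}`, column `k` = subset sum of the states `cols k`. -/
def cfgMat (U : Fin n → Finset (Fin h)) (cols : Fin n → Finset (Fin K)) (g : Fin K → Fin h → ℂ) :
    Matrix (Fin n) (Fin n) ℂ :=
  Matrix.of fun i k : Fin n => ∏ a ∈ U i, ∑ q ∈ cols k, g q a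

/-- Its symbolic version (table entries as indeterminates `X (q, a)`). -/
def symMat (U : Fin n → Finset (Fin h)) (cols : Fin n → Finset (Fin K)) :
    Matrix (Fin n) (Fin n) (MvPolynomial (Fin K × Fin h) ℂ) :=
  Matrix.of fun i k : Fin n => ∏ a ∈ U i, ∑ q ∈ cols k, X (q, a)

/-- Evaluating the symbolic determinant at a table gives the numeric determinant. -/
theorem eval_det_symMat (U : Fin n → Finset (Fin h)) (cols : Fin n → Finset (Fin K)) (x : Fin K × Fin h → ℂ) :
    MvPolynomial.eval x (symMat U cols).det = (cfgMat U cols fun q a => x (q, a)).det := by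
  rw [RingHom.map_det, RingHom.mapMatrix_apply]
  congr 1
  refine Matrix.ext fun i k => ?_
  simp [symMat, cfgMat, Matrix.map_apply, map_prod, map_sum]

/-- **A common generic table.** If every family `fam t` (finitely many, same columns) admits a table with nonsingular
configuration matrix, one table works for all of them. -/
theorem exists_common_table {T : Type*} [Fintype T] (fam : T → (Fin n → Finset (Fin h))) (cols : Fin n → Finset (Fin K))
    (hgood : ∀ t, ∃ g : Fin K → Fin h → ℂ, (cfgMat (fam t) cols g).det ≠ 0) :
    ∃ g : Fin K → Fin h → ℂ, ∀ t, (cfgMat (fam t) cols g).det ≠ 0 := by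
  classical
  set p : MvPolynomial (Fin K × Fin h) ℂ := ∏ t : T, (symMat (fam t) cols).det with hp
  have hfac : ∀ t, (symMat (fam t) cols).det ≠ 0 := by
    intro t h0
    obtain ⟨g, hg⟩ := hgood t
    have hev := eval_det_symMat (fam t) cols (fun p : Fin K × Fin h => g p.1 p.2)
    rw [h0, map_zero] at hev
    exact hg (by simpa using hev.symm)
  have hpne : p ≠ 0 := Finset.prod_ne_zero_iff.mpr fun t _ => hfac t
  have hex : ∃ x : Fin K × Fin h → ℂ, MvPolynomial.eval x p ≠ 0 := by
    by_contra hall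
    push Not at hall
    exact hpne (MvPolynomial.funext fun x => by rw [hall x, map_zero])
  obtain ⟨x, hx⟩ := hex
  refine ⟨fun q a => x (q, a), fun t => ?_⟩
  rw [hp, map_prod] at hx
  have ht := (Finset.prod_ne_zero_iff.mp hx) t (Finset.mem_univ t)
  rwa [eval_det_symMat] at ht

end PairBlock

end

end Summit.ValiantsHypothesis.ValiantsHypothesis.Theorems.BarrierLever.HiddenStates
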